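import Summits.BirchSwinnertonDyer.BirchSwinnertonDyer.Theorems.EisensteinPrimesFullDescentNoUnramifiedCharacter
import Literature.NumberTheory.EllipticCurves.PointDivisibilityProofs
import Literature.NumberTheory.EllipticCurves.CMTorsionIrreducibleOrdinaryProofs
import Literature.NumberTheory.EllipticCurves.GaloisActionProofs
import Literature.NumberTheory.EllipticCurves.GreenbergSelmer
import HarnessLib

/-!
# Route `EisensteinPrimes`, crux 2 `GoodLatticeBDPValue` (stmt-BirchSwinnertonDyer-19032), line `halves` v21, stub 3a-B
# `stub_fullDescentAtThreeOfRed`, Theorem A-II — the GLOBAL brick by the QUOTIENT character: **if the inertia groups at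
# every place act trivially on `E[9]/B` (`B ≤ E[9]` of order `9`, `Γ_ℚ`-stable, `E[3] ⊄ B`), then ALL of `Γ_ℚ` does**

Cell `bsd-eis`, width seat `bsd-line-x1-p1-w2` (gen 5; `--supports -19032`, closes nothing by itself). In Theorem A-II of the
`E[9]` road (`HOME/line-x1-p1-w3-g4/AN3-StubB-elementary-road.md` §4; LEAD gen 5 18:23Z/18:30Z) one must show that `Γ_ℚ`
acts trivially on `E[9]/B` for the `Γ_ℚ`-stable cyclic `B ≤ E[9]` of Theorem A-I — contradicting Serre's «`D₃` is NOT trivial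
on `E[9]/K₂`» (`#Ẽ(𝔽₃) ≤ 7 < 9`). This file does the global step WITHOUT the Weil pairing and without identifying the
character of `B`: the quotient `E[9]/B` is cyclic of order `9`, its character `ψ′ : Γ_ℚ → (ℤ/9)ˣ` has open kernel and kills
one inertia group above every place by hypothesis, hence `ψ′ = 1` by «ℚ has no unramified extensions»
(`FullDescentNoUnramifiedCharacter.monoidHom_eq_one_of_forall_greenbergInertia`).

* §1 (any group `Γ` acting on an additive group `M`): `exists_quotientCharacter` — for a `Γ`-stable `B ≤ M` and `y₀` of
  order `m` modulo `B` with `σ y₀ ≡ k_σ y₀ (mod B)`, a homomorphism `ψ : Γ → (ℤ/m)ˣ` with `σ y₀ ≡ ψ(σ) y₀ (mod B)`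
  (the quotient twin of the tree's `exists_cyclicCharacter_of_addOrderOf`); `smul_sub_mem_of_mem_sup` (the congruence on all
  of `B + ℤ y₀`); `quotientCharacter_eq_one_of_smul_sub_mem` (uniqueness of the scalar).
* §2 (`W/ℚ`): `forall_smul_sub_mem_of_forall_absInertia` — `B ≤ E[9]`, `#B = 9`, `E[3] ⊄ B`, `B` `Γ_ℚ`-stable, and for every
  place `v` and every `τ` in the local inertia group `absInertia ℚ_v`, `res τ` acts trivially on `E[9]/B` ⟹ every
  `σ ∈ Γ_ℚ` acts trivially on `E[9]/B`.

HONEST FRAMING: helper theorems only (0 definitions, 0 named facts, 0 sorry); no summit statement, no BSD / IMC / Keller–Yin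
theorem, no stub of the registered skeleton is proved here. References: [Mazur1978] §5 p. 148 (isogeny characters);
[SerreInventiones1972] §1.11; [NeukirchANT1999] III (2.18) (Minkowski: no unramified extension of ℚ).
-/

set_option autoImplicit false
-- the route's Theorems namespace repeats the summit name by design (D-0017 nested layout)
set_option linter.dupNamespace false

noncomputable section

open scoped Classical NumberField

namespace Summit.BirchSwinnertonDyer.BirchSwinnertonDyer.Theorems.FullDescentQuotientCharacter

open Function NumberField IsDedekindDomain Field WeierstrassCurve
  Literature.NumberTheory.GaloisRepresentations Literature.NumberTheory.EllipticCurves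
  Summit.BirchSwinnertonDyer.BirchSwinnertonDyer.Theorems.FullDescentNoUnramifiedCharacter

/-! ## §1. The character of a cyclic quotient -/

section Generic

variable {Γ M : Type*} [Group Γ] [AddCommGroup M] [DistribMulAction Γ M]

/-- Congruence of integer multiples of `y₀` modulo `B` is congruence modulo the order `m` of `y₀ mod B`. [folklore] -/
theorem zsmul_sub_zsmul_mem_iff (B : AddSubgroup M) {m : ℕ} {y₀ : M} (hord : ∀ k : ℤ, k • y₀ ∈ B ↔ (m : ℤ) ∣ k)
    (a b : ℤ) : a • y₀ - b • y₀ ∈ B ↔ (a : ZMod m) = (b : ZMod m) := by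
  rw [← sub_smul, hord, ZMod.intCast_eq_intCast_iff_dvd_sub, dvd_sub_comm]

/-- Uniqueness of the scalar: two integers by which `z` is congruent to a multiple of `y₀` agree mod `m`. [folklore] -/
theorem intCast_eq_of_sub_zsmul_mem (B : AddSubgroup M) {m : ℕ} {y₀ : M} (hord : ∀ k : ℤ, k • y₀ ∈ B ↔ (m : ℤ) ∣ k)
    {a b : ℤ} {z : M} (ha : z - a • y₀ ∈ B) (hb : z - b • y₀ ∈ B) : (a : ZMod m) = (b : ZMod m) := by
  rw [← zsmul_sub_zsmul_mem_iff B hord]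
  have h := B.sub_mem hb ha
  rwa [sub_sub_sub_cancel_left] at h

/-- **The character of a cyclic quotient.** `Γ` a group acting on the additive group `M` by automorphisms, `B ≤ M` a
`Γ`-stable subgroup, `y₀ ∈ M` of order `m` modulo `B` (`k y₀ ∈ B ↔ m ∣ k`) whose `Γ`-translates are integer multiples of
`y₀` modulo `B`. Then there is a homomorphism `ψ : Γ → (ℤ/m)ˣ` with `σ y₀ ≡ ψ(σ) y₀ (mod B)` — the character of `Γ` on the
cyclic group `(B + ℤ y₀)/B`. (Quotient twin of Mazur's isogeny character / the tree's `exists_cyclicCharacter_of_addOrderOf`.)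
[cite: Mazur1978, §5 (p. 148, definition of the isogeny character)] -/
theorem exists_quotientCharacter (B : AddSubgroup M) (hB : ∀ σ : Γ, ∀ x ∈ B, σ • x ∈ B) {m : ℕ} [NeZero m]
    {y₀ : M} (hord : ∀ k : ℤ, k • y₀ ∈ B ↔ (m : ℤ) ∣ k) (hst : ∀ σ : Γ, ∃ k : ℤ, σ • y₀ - k • y₀ ∈ B) :
    ∃ ψ : Γ →* (ZMod m)ˣ, ∀ σ : Γ, σ • y₀ - (((ψ σ : (ZMod m)ˣ) : ZMod m).val : ℤ) • y₀ ∈ B := by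
  choose k hk using hst
  -- multiplicativity modulo `B`
  have hkey : ∀ σ τ : Γ, (σ * τ) • y₀ - (k σ * k τ) • y₀ ∈ B := by
    intro σ τ
    have h1 : σ • (k τ • y₀) = k τ • (σ • y₀) := map_zsmul (DistribSMul.toAddMonoidHom M σ) (k τ) y₀
    have e : (σ * τ) • y₀ - (k σ * k τ) • y₀ =
        k τ • (σ • y₀ - k σ • y₀) + σ • (τ • y₀ - k τ • y₀) := by
      rw [mul_smul, smul_sub σ (τ • y₀), h1]
      generalize σ • (τ • y₀) = A
      generalize σ • y₀ = S
      module
    rw [e]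
    exact B.add_mem (B.zsmul_mem (hk σ) _) (hB σ _ (hk τ))
  have hone : ((k 1 : ℤ) : ZMod m) = 1 := by
    have h : y₀ - (1 : ℤ) • y₀ ∈ B := by rw [one_zsmul, sub_self]; exact B.zero_mem
    have h' : y₀ - k 1 • y₀ ∈ B := by have := hk 1; rwa [one_smul] at this
    rw [intCast_eq_of_sub_zsmul_mem B hord h' h, Int.cast_one]
  have hmul : ∀ σ τ : Γ, ((k (σ * τ) : ℤ) : ZMod m) = (k σ : ZMod m) * (k τ : ZMod m) := fun σ τ ↦ by
    rw [← Int.cast_mul]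
    exact intCast_eq_of_sub_zsmul_mem B hord (hk (σ * τ)) (hkey σ τ)
  let r₀ : Γ →* ZMod m :=
    { toFun := fun σ ↦ (k σ : ZMod m), map_one' := hone, map_mul' := hmul }
  refine ⟨r₀.toHomUnits, fun σ ↦ ?_⟩
  rw [MonoidHom.coe_toHomUnits]
  show σ • y₀ - (((k σ : ℤ) : ZMod m).val : ℤ) • y₀ ∈ B
  have h2 : k σ • y₀ - (((k σ : ℤ) : ZMod m).val : ℤ) • y₀ ∈ B :=
    (zsmul_sub_zsmul_mem_iff B hord _ _).mpr (by rw [Int.cast_natCast, ZMod.natCast_zmod_val])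
  have h := B.add_mem (hk σ) h2
  rwa [sub_add_sub_cancel] at h

/-- The congruence `σ y ≡ c y (mod B)` propagates from `y₀` to all of `B + ℤ y₀` (`B` `Γ`-stable). [folklore] -/
theorem smul_sub_mem_of_mem_sup (B : AddSubgroup M) (hB : ∀ σ : Γ, ∀ x ∈ B, σ • x ∈ B) {y₀ : M}
    (σ : Γ) {c : ℤ} (hσ : σ • y₀ - c • y₀ ∈ B) {y : M} (hy : ∃ b ∈ B, ∃ j : ℤ, y = b + j • y₀) :
    σ • y - c • y ∈ B := by
  obtain ⟨b, hb, j, rfl⟩ := hy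
  have h1 : σ • (j • y₀) = j • (σ • y₀) := map_zsmul (DistribSMul.toAddMonoidHom M σ) j y₀
  have e : σ • (b + j • y₀) - c • (b + j • y₀) = (σ • b - c • b) + j • (σ • y₀ - c • y₀) := by
    rw [smul_add, h1]
    generalize σ • b = A
    generalize σ • y₀ = S
    module
  rw [e]
  exact B.add_mem (B.sub_mem (hB σ b hb) (B.zsmul_mem hb c)) (B.zsmul_mem hσ j)

/-- Uniqueness: if `σ` fixes `y₀` modulo `B`, the quotient character is `1` at `σ`. [folklore] -/
theorem quotientCharacter_eq_one_of_smul_sub_mem (B : AddSubgroup M) {m : ℕ} [NeZero m] {y₀ : M}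
    (hord : ∀ k : ℤ, k • y₀ ∈ B ↔ (m : ℤ) ∣ k) {ψ : Γ →* (ZMod m)ˣ} {σ : Γ}
    (hψ : σ • y₀ - (((ψ σ : (ZMod m)ˣ) : ZMod m).val : ℤ) • y₀ ∈ B) (hfix : σ • y₀ - y₀ ∈ B) : ψ σ = 1 := by
  have h1 : σ • y₀ - (1 : ℤ) • y₀ ∈ B := by rwa [one_zsmul]
  have h := intCast_eq_of_sub_zsmul_mem B hord hψ h1
  rw [Int.cast_natCast, ZMod.natCast_zmod_val, Int.cast_one] at h
  exact Units.ext h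

end Generic

/-! ## §2. `Γ_ℚ` is trivial on `E[9]/B` as soon as every inertia group is -/

/-- Bézout at `9`: if `k y₀ ∈ B`, `9 y₀ ∈ B` but `3 y₀ ∉ B`, then `9 ∣ k`. [folklore] -/
theorem nine_dvd_of_zsmul_mem {M : Type*} [AddCommGroup M] (B : AddSubgroup M) {y₀ : M}
    (h9 : (9 : ℤ) • y₀ ∈ B) (h3 : (3 : ℤ) • y₀ ∉ B) {k : ℤ} (hk : k • y₀ ∈ B) : (9 : ℤ) ∣ k := by
  by_contra hnd
  -- `g = gcd(k, 9)` divides `3`, and `g • y₀ ∈ B`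
  have hg : (Int.gcd k 9 : ℤ) • y₀ ∈ B := by
    rw [Int.gcd_eq_gcd_ab k 9, add_zsmul, mul_comm k, mul_zsmul, mul_comm (9 : ℤ), mul_zsmul]
    exact B.add_mem (B.zsmul_mem hk _) (B.zsmul_mem h9 _)
  have hg9 : Int.gcd k 9 ∣ 9 := Int.gcd_dvd_natAbs_right k 9
  have hgne : Int.gcd k 9 ≠ 9 := fun h ↦ hnd (by
    have := Int.gcd_dvd_left k 9
    rw [h] at this
    exact_mod_cast this)
  have hg3 : Int.gcd k 9 ∣ 3 := by
    have hg9' : Int.gcd k 9 ∣ 3 ^ 2 := by norm_num; exact hg9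
    obtain ⟨i, hi, hgi⟩ := (Nat.dvd_prime_pow Nat.prime_three).mp hg9'
    interval_cases i
    · rw [hgi]; norm_num
    · rw [hgi]; norm_num
    · exact absurd (by rw [hgi]; norm_num) hgne
  obtain ⟨c, hc⟩ := hg3
  apply h3
  have e : (3 : ℤ) = (c : ℤ) * (Int.gcd k 9 : ℤ) := by rw [mul_comm]; exact_mod_cast hc
  rw [e, mul_zsmul]
  exact B.zsmul_mem hg _

/-- **`Γ_ℚ` acts trivially on `E[9]/B` as soon as one inertia group above every place does.** `W/ℚ` elliptic,
`B ≤ E[9]` a `Γ_ℚ`-stable subgroup of order `9` not containing `E[3]`; suppose that for every finite place `v` and every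
`τ` in the inertia group `absInertia ℚ_v ≤ Γ_{ℚ_v}`, `res τ` acts trivially on `E[9]/B`. Then every `σ ∈ Γ_ℚ` acts
trivially on `E[9]/B`. Proof: `E[9]/B` is cyclic of order `9` (generated by any `y₀ ∈ E[9]` with `3 y₀ ∉ B`, which exists
as `3 E[9] = E[3] ⊄ B`); its character `ψ′ : Γ_ℚ → (ℤ/9)ˣ` (§1) has open kernel (it contains the stabiliser of `y₀`) and
kills the inertia group `GreenbergSelmer.inertia v` of the chosen prime above every `v`, so `ψ′ = 1` because ℚ has no
non-trivial everywhere-unramified abelian extension (`monoidHom_eq_one_of_forall_greenbergInertia`).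
[cite: NeukirchANT1999, Ch. III (2.18)] [cite: Mazur1978, §5 (p. 148)] [cite: SerreInventiones1972, §1.11] -/
theorem forall_smul_sub_mem_of_forall_absInertia (W : WeierstrassCurve ℚ) [W.IsElliptic]
    {B : AddSubgroup (geomPoints W)} (hBle : B ≤ geomTorsion W ((9 : ℕ) : ℤ)) (hBcard : Nat.card B = 9)
    (hB3 : ¬ geomTorsion W ((3 : ℕ) : ℤ) ≤ B)
    (hBst : ∀ σ : absoluteGaloisGroup ℚ, ∀ x ∈ B, σ • x ∈ B)
    (hI : ∀ (v : HeightOneSpectrum (𝓞 ℚ)), ∀ τ ∈ absInertia (v.adicCompletion ℚ),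
      ∀ y ∈ geomTorsion W ((9 : ℕ) : ℤ), absGaloisRestrict ℚ (v.adicCompletion ℚ) τ • y - y ∈ B) :
    ∀ σ : absoluteGaloisGroup ℚ, ∀ y ∈ geomTorsion W ((9 : ℕ) : ℤ), σ • y - y ∈ B := by
  set T : AddSubgroup (geomPoints W) := geomTorsion W ((9 : ℕ) : ℤ) with hTdef
  have hT9 : ∀ y ∈ T, (9 : ℤ) • y = 0 := fun y hy ↦ by
    have h := (mem_torsionPoints_iff _ _ y).mp hy
    exact_mod_cast h
  have hTst : ∀ (σ : absoluteGaloisGroup ℚ), ∀ y ∈ T, σ • y ∈ T := fun σ _ hy ↦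
    smul_mem_torsionPoints W (AlgebraicClosure ℚ) σ hy
  -- a point `y₀ ∈ E[9]` with `3 y₀ ∉ B` (as `3 E[9] = E[3] ⊄ B`)
  obtain ⟨y₀, hy₀T, hy₀3⟩ : ∃ y₀ ∈ T, (3 : ℤ) • y₀ ∉ B := by
    by_contra hnone
    push Not at hnone
    apply hB3
    intro z hz
    have hz3 : (3 : ℤ) • z = 0 := by
      have h := (mem_torsionPoints_iff _ _ z).mp hz
      exact_mod_cast h
    obtain ⟨y, hy⟩ := W.zsmul_geomPoints_surjective_holds (n := 3) (by norm_num) z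
    have hy' : (3 : ℤ) • y = z := hy
    have hy9 : (((9 : ℕ) : ℤ)) • y = 0 := by
      rw [show (((9 : ℕ) : ℤ)) = 3 * 3 by norm_num, mul_zsmul, hy', hz3]
    have hyT : y ∈ T := (mem_torsionPoints_iff _ _ y).mpr hy9
    rw [← hy']
    exact hnone y hyT
  have hy₀9 : (9 : ℤ) • y₀ ∈ B := by rw [hT9 y₀ hy₀T]; exact B.zero_mem
  have hord : ∀ k : ℤ, k • y₀ ∈ B ↔ ((9 : ℕ) : ℤ) ∣ k := fun k ↦ by
    refine ⟨fun hk ↦ nine_dvd_of_zsmul_mem B hy₀9 hy₀3 hk, fun ⟨c, hc⟩ ↦ ?_⟩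
    rw [hc, mul_comm, mul_zsmul]
    exact B.zsmul_mem (by exact_mod_cast hy₀9) c
  -- `E[9] = B + ℤ y₀` by counting in the quotient `E[9]/B`
  haveI hTfin : Finite T := Nat.finite_of_card_ne_zero (by
    rw [hTdef, natCard_geomTorsion_natCast W (n := 9) (by norm_num)]; norm_num)
  have hTcard : Nat.card T = 81 := by
    rw [hTdef, natCard_geomTorsion_natCast W (n := 9) (by norm_num)]; norm_num
  set B' : AddSubgroup T := B.addSubgroupOf T with hB'def
  have hB'card : Nat.card B' = 9 := by
    rw [hB'def, Nat.card_congr (AddSubgroup.addSubgroupOfEquivOfLe hBle).toEquiv, hBcard]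
  have hQcard : Nat.card (T ⧸ B') = 9 := by
    have h := B'.card_eq_card_quotient_mul_card_addSubgroup
    rw [hTcard, hB'card] at h
    omega
  set q₀ : T ⧸ B' := QuotientAddGroup.mk ⟨y₀, hy₀T⟩ with hq₀def
  have hq₀zsmul : ∀ k : ℤ, k • q₀ = 0 ↔ ((9 : ℕ) : ℤ) ∣ k := fun k ↦ by
    rw [hq₀def, ← QuotientAddGroup.mk_zsmul, QuotientAddGroup.eq_zero_iff, hB'def, AddSubgroup.mem_addSubgroupOf,
      AddSubgroupClass.coe_zsmul]
    exact hord k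
  have hq₀ord : addOrderOf q₀ = 9 := by
    have h9 : addOrderOf q₀ ∣ 9 := by
      apply addOrderOf_dvd_of_nsmul_eq_zero
      rw [← natCast_zsmul]
      exact (hq₀zsmul 9).mpr (by norm_num)
    have hdvd : ((9 : ℕ) : ℤ) ∣ (addOrderOf q₀ : ℤ) := (hq₀zsmul _).mp (by
      rw [natCast_zsmul]; exact addOrderOf_nsmul_eq_zero q₀)
    exact Nat.dvd_antisymm h9 (by exact_mod_cast hdvd)
  have hgen : AddSubgroup.zmultiples q₀ = ⊤ := by
    haveI : Finite (T ⧸ B') := Nat.finite_of_card_ne_zero (by rw [hQcard]; norm_num)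
    exact AddSubgroup.eq_top_of_card_eq _ (by rw [Nat.card_zmultiples, hq₀ord, hQcard])
  have hdec : ∀ y ∈ T, ∃ b ∈ B, ∃ j : ℤ, y = b + j • y₀ := by
    intro y hy
    have hmem : (QuotientAddGroup.mk ⟨y, hy⟩ : T ⧸ B') ∈ AddSubgroup.zmultiples q₀ := by
      rw [hgen]; exact AddSubgroup.mem_top _
    obtain ⟨j, hj⟩ := AddSubgroup.mem_zmultiples_iff.mp hmem
    rw [hq₀def, ← QuotientAddGroup.mk_zsmul] at hj
    have h := QuotientAddGroup.eq_iff_sub_mem.mp hj.symm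
    rw [hB'def, AddSubgroup.mem_addSubgroupOf, AddSubgroupClass.coe_sub, AddSubgroupClass.coe_zsmul] at h
    exact ⟨y - j • y₀, h, j, by abel⟩
  -- the quotient character `ψ′`
  have hst : ∀ σ : absoluteGaloisGroup ℚ, ∃ k : ℤ, σ • y₀ - k • y₀ ∈ B := by
    intro σ
    obtain ⟨b, hb, j, hj⟩ := hdec (σ • y₀) (hTst σ y₀ hy₀T)
    exact ⟨j, by rw [hj, add_sub_cancel_right]; exact hb⟩
  obtain ⟨ψ, hψ⟩ := exists_quotientCharacter B hBst hord hst
  -- `ψ′` has open kernel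
  have hker : IsOpen ((ψ.ker : Subgroup (absoluteGaloisGroup ℚ)) : Set (absoluteGaloisGroup ℚ)) := by
    apply Subgroup.isOpen_mono (H₁ := MulAction.stabilizer (absoluteGaloisGroup ℚ) y₀) _ (isOpen_stabilizer_point_holds W y₀)
    intro σ hσ
    rw [MonoidHom.mem_ker]
    refine quotientCharacter_eq_one_of_smul_sub_mem B hord (hψ σ) ?_
    rw [MulAction.mem_stabilizer_iff.mp hσ, sub_self]
    exact B.zero_mem
  -- `ψ′` kills the inertia group of the chosen prime above every place
  have hinert : ∀ v : HeightOneSpectrum (𝓞 ℚ), ∀ τ ∈ GreenbergSelmer.inertia (K := ℚ) v, ψ τ = 1 := by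
    intro v τ hτ
    obtain ⟨τ', hτ', hτ'eq⟩ := Subgroup.mem_map.mp hτ
    have hτeq : absGaloisRestrict ℚ (v.adicCompletion ℚ) τ' = τ := hτ'eq
    refine quotientCharacter_eq_one_of_smul_sub_mem B hord (hψ τ) ?_
    rw [← hτeq]
    exact hI v τ' hτ' y₀ hy₀T
  have hψ1 : ψ = 1 := monoidHom_eq_one_of_forall_greenbergInertia ψ hker hinert
  -- conclusion
  haveI : Fact (1 < 9) := ⟨by norm_num⟩
  intro σ y hy
  have h1 : σ • y₀ - (1 : ℤ) • y₀ ∈ B := by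
    have h := hψ σ
    rwa [hψ1, MonoidHom.one_apply, Units.val_one, ZMod.val_one, Nat.cast_one] at h
  have h := smul_sub_mem_of_mem_sup B hBst σ h1 (hdec y hy)
  rwa [one_zsmul] at h

end Summit.BirchSwinnertonDyer.BirchSwinnertonDyer.Theorems.FullDescentQuotientCharacter

end
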